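import Summits.QuantumFields.YangMills.Theses.LangevinControlUV
import Summits.QuantumFields.YangMills.Theorems.LatticeGapInUVUnits.Negative.LatticeGapInUVUnitsFalseOfStandardScalingSU
import Summits.QuantumFields.YangMills.Theorems.LatticeGapInUVUnits.Negative.WeakCouplingConcentration

/-!
# `LatticeGapInUVUnitsC` — `a → 0` is load-bearing (modulo `XiUnbounded`); tightness of `0 < Γ` under continuity

Negative-side file (cdisprove, cycle 1) for crux `stmt-QuantumFields-16206` =
`Summit.QuantumFields.YangMills.Theses.LangevinControlUV.LatticeGapInUVUnitsC` (route `LangevinControlUV`, rank 5),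
the repair C′ (`Continuous a →` inserted) of the parent crux `LatticeGapInUVUnits` (stmt-9366).

## Results (sorry-free; axioms `propext`, `Classical.choice`, `Quot.sound`)

* `plaqField_swap` (`P_x^{ij} = P_x^{ji}`: inverted holonomy, inversion-invariant real trace of a unitary) and
  `tendsto_wcov_plaqField`: ALL plaquette covariances of a fixed torus vanish as `β → ∞`, for all ordered pairs of
  distinct directions (the proved concentration `tendsto_cov_plaquetteCost`, symmetrised).
* `shape_tendsto_zero_nhdsGT_of_continuous` (`H`-free TIGHTNESS, new under C′): a continuous positive `a → 0` obeying
  the axis LOWER bound of the package at the single box `L = 8`, `n = 1` forces `Γ(s) → 0` as `s ↓ 0` as a genuine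
  one-sided limit (every small level is a value of `a` at a LARGE coupling — positivity on compacts and intermediate
  values — where the covariance is small). The typed parent only forced `Γ(a β) → 0` along the range of `a`
  (`shape_tendsto_zero_of_femto_lower_bound`).
* THE CRUX WITHOUT `a → 0` (the body of `LatticeGapInUVUnitsC` with the conjunct `Filter.Tendsto a atTop (nhds 0)`
  deleted, written INLINE — no named Prop is introduced for a statement believed false): it implies the crux
  (`latticeGapInUVUnitsC_of_withoutTendsto`) and is FALSE modulo `H`
  (`latticeGapInUVUnitsC_withoutTendsto_false_of_xiUnbounded`): the continuous constant ruler `a ≡ 2` has no femto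
  box for `ℓ₀ = 1`, carries the package vacuously, and the conclusion is then a `β`-uniform gap in LATTICE units,
  against `not_concl_const_of_xiUnbounded`.
* `H = XiUnbounded (suFund N)` for one `N ≥ 2` (the parent file's `@[conjecture]`, taken as an explicit hypothesis;
  no new named Prop) — only the weak INFRARED half of the parent's `StandardScalingSU`: the correlation length of
  `SU(N)₄` is unbounded in lattice units along some `β_j → ∞` (Chatterjee, arXiv:1803.01950, Problem 5.1; open,
  universally believed); no ultraviolet statement.

Companion: `Negative/LowerBoundLoadBearing.lean` (the package's LOWER bound is load-bearing: continuous slow rulers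
carry the upper-only package unconditionally, `Negative/ContinuousSlowRulers.lean`). Neither is a refutation of the
crux: the weakened statements are strictly stronger than the item, which is the physical mass gap in the package's
units (standing Disproof verdict: no kill; `Cruxes/LatticeGapInUVUnitsC/Disproof.lean`).
-/

namespace Summit.QuantumFields.YangMills.Theorems.LatticeGapInUVUnitsC.Negative

open Filter Topology MeasureTheory
open Literature.MathematicalPhysics.QuantumFieldTheory Literature.MathematicalPhysics.QuantumLattice
open Summit.QuantumFields.YangMills.Theses.LangevinControlUV (LatticeGapInUVUnitsC)
open Summit.QuantumFields.YangMills.Theorems.LatticeGapInUVUnits.Negative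

noncomputable section

/-! ## Fixed-torus covariances at weak coupling, all direction pairs -/

section Gauge

variable {G : Type} [Group G] [TopologicalSpace G] [IsTopologicalGroup G] [CompactSpace G]
  [MeasurableSpace G] [BorelSpace G]

omit [IsTopologicalGroup G] [CompactSpace G] [MeasurableSpace G] [BorelSpace G] in
/-- `Re tr ρ(g⁻¹) = Re tr ρ(g)` for a unitary matrix representation. [folklore] -/
theorem re_trace_map_inv_of_unitary (r : LatticeRep G) (g : G) : (r.ρ g⁻¹).trace.re = (r.ρ g).trace.re := by
  have hu := Matrix.mem_unitaryGroup_iff.1 (r.mem_unitary g)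
  have hstar : r.ρ g⁻¹ = star (r.ρ g) := by
    calc r.ρ g⁻¹ = r.ρ g⁻¹ * (r.ρ g * star (r.ρ g)) := by rw [hu, mul_one]
      _ = r.ρ g⁻¹ * r.ρ g * star (r.ρ g) := by rw [mul_assoc]
      _ = star (r.ρ g) := by rw [← map_mul, inv_mul_cancel, map_one, one_mul]
  rw [hstar, Matrix.star_eq_conjTranspose, Matrix.trace_conjTranspose, Complex.star_def, Complex.conj_re]

omit [IsTopologicalGroup G] [CompactSpace G] [MeasurableSpace G] [BorelSpace G] in
/-- The plaquette field is symmetric in its two directions: `P_x^{ij} = P_x^{ji}` (the holonomy is inverted, the real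
trace of a unitary is inversion invariant). [folklore] -/
theorem plaqField_swap (r : LatticeRep G) {L : ℕ} (x : Site 4 L) (i j : Fin 4) :
    plaqField r x i j = plaqField r x j i := by
  funext U
  have hswap : plaquetteHolonomy U x i j = (plaquetteHolonomy U x j i)⁻¹ := by
    simp only [plaquetteHolonomy, mul_inv_rev, inv_inv, mul_assoc]
  unfold plaqField
  rw [hswap, re_trace_map_inv_of_unitary]

/-- **All plaquette covariances of a fixed torus vanish at weak coupling**, for all ordered pairs of distinct
directions (reduction to `tendsto_cov_plaquetteCost` by the direction symmetry). [folklore] -/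
theorem tendsto_wcov_plaqField (r : LatticeRep G) (L : ℕ) [NeZero L] (x y : Site 4 L) {i j i' j' : Fin 4}
    (hij : i ≠ j) (hij' : i' ≠ j') :
    Tendsto (fun β => wcov r β (plaqField r x i j) (plaqField r y i' j')) atTop (𝓝 0) := by
  -- sorted versions of the two plaquettes
  have key : ∀ (k l : Fin 4) (hkl : k < l) (k' l' : Fin 4) (hkl' : k' < l'),
      Tendsto (fun β => wcov r β (plaqField r x k l) (plaqField r y k' l')) atTop (𝓝 0) :=
    fun k l hkl k' l' hkl' => tendsto_cov_plaquetteCost r L (x, ⟨(k, l), hkl⟩) (y, ⟨(k', l'), hkl'⟩)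
  rcases lt_or_gt_of_ne hij with h1 | h1 <;> rcases lt_or_gt_of_ne hij' with h2 | h2
  · exact key _ _ h1 _ _ h2
  · rw [plaqField_swap r y i' j']; exact key _ _ h1 _ _ h2
  · rw [plaqField_swap r x i j]; exact key _ _ h1 _ _ h2
  · rw [plaqField_swap r x i j, plaqField_swap r y i' j']; exact key _ _ h1 _ _ h2

/-! ## Tightness of `0 < Γ` under continuity -/

/-- **Tightness under the repair C′: the shape function vanishes at `0⁺` as a genuine one-sided limit.** If a
CONTINUOUS positive unit map `a → 0` satisfies the axis LOWER bound of the femto package at the single box `L = 8`,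
`n = 1` (`c Γ(a β) ≤ Cov_{β,8}(P_0^{01}, P_{e₂}^{01})` whenever `β ≥ β₀` and `8 a β ≤ ℓ₀`, `c > 0`, `Γ ≥ 0` on
`(0, ℓ₀]`), then `Γ(s) → 0` as `s ↓ 0`: every small level `s` is a value `a β` with `β` LARGE (continuity,
positivity on compacts, intermediate values), where the covariance is small (concentration). The typed item only
forced `Γ(a β) → 0` along the range of `a` (`shape_tendsto_zero_of_femto_lower_bound`); under C′ the
"asymptotic-freedom dividend" `Γ(0⁺) = 0` is a theorem about the shape function itself. [folklore] -/
theorem shape_tendsto_zero_nhdsGT_of_continuous (r : LatticeRep G) {a Γ : ℝ → ℝ} {β₀ ℓ₀ c : ℝ}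
    (hc : 0 < c) (hℓ₀ : 0 < ℓ₀) (ha : Continuous a) (hpos : ∀ β, 0 < a β) (hlim : Tendsto a atTop (𝓝 0))
    (hΓ : ∀ s : ℝ, 0 < s → s ≤ ℓ₀ → 0 ≤ Γ s)
    (hlow : ∀ β : ℝ, β₀ ≤ β → 8 * a β ≤ ℓ₀ → c * Γ (a β) ≤ axisCov r 8 β 1) :
    Tendsto Γ (𝓝[>] 0) (𝓝 0) := by
  haveI : NeZero (8 : ℕ) := ⟨by norm_num⟩
  have hcov : Tendsto (fun β => axisCov r 8 β 1) atTop (𝓝 0) :=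
    tendsto_wcov_plaqField r 8 (0 : Site 4 8) (Pi.single (2 : Fin 4) (((1 : ℕ) : ℕ) : ZMod 8))
      (show (0 : Fin 4) ≠ 1 by decide) (show (0 : Fin 4) ≠ 1 by decide)
  refine Metric.tendsto_nhdsWithin_nhds.2 fun ε hε => ?_
  -- beyond `B ≥ β₀`: the covariance is `< c ε` and the box `L = 8` is femto
  have hev : ∀ᶠ β in atTop, axisCov r 8 β 1 < c * ε ∧ 8 * a β ≤ ℓ₀ := by
    refine (hcov.eventually (gt_mem_nhds (by positivity))).and ?_
    have h8 : Tendsto (fun β => 8 * a β) atTop (𝓝 0) := by simpa using hlim.const_mul (8 : ℝ)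
    exact (h8.eventually (gt_mem_nhds hℓ₀)).mono fun β hβ => hβ.le
  obtain ⟨B₁, hB₁⟩ := eventually_atTop.1 hev
  set B := max β₀ B₁ with hBdef
  -- `δ` := the minimum of `a` on `[β₀, B]`
  obtain ⟨βm, hβm, hmin⟩ := (isCompact_Icc (a := β₀) (b := B)).exists_isMinOn
    (Set.nonempty_Icc.2 (le_max_left _ _)) ha.continuousOn
  refine ⟨a βm, hpos βm, fun {s} hs hsd => ?_⟩
  rw [Set.mem_Ioi] at hs
  rw [Real.dist_eq, sub_zero, abs_of_pos hs] at hsd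
  -- `s` is a value `a β` with `β ≥ B`: `a B ≥ a βm > s` and `a → 0`
  have haB : s ≤ a B := (hsd.trans_le (hmin (Set.right_mem_Icc.2 (le_max_left _ _)))).le
  obtain ⟨B', hB'⟩ := eventually_atTop.1 ((hlim.eventually (gt_mem_nhds hs)))
  have hB'B : B ≤ max B B' := le_max_left _ _
  have haB' : a (max B B') ≤ s := (hB' _ (le_max_right _ _)).le
  obtain ⟨β, hβI, hβs⟩ : ∃ β ∈ Set.Icc B (max B B'), a β = s :=
    intermediate_value_Icc' hB'B ha.continuousOn ⟨haB', haB⟩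
  have hβB : B ≤ β := hβI.1
  obtain ⟨hcovβ, hfem⟩ := hB₁ β ((le_max_right _ _).trans hβB)
  have hlowβ := hlow β ((le_max_left _ _).trans hβB) hfem
  rw [hβs] at hlowβ hfem
  have hΓs : 0 ≤ Γ s := hΓ s hs (by linarith)
  rw [Real.dist_eq, sub_zero, abs_of_nonneg hΓs]
  by_contra hcon
  push Not at hcon
  have : c * ε ≤ c * Γ s := mul_le_mul_of_nonneg_left hcon hc.le
  linarith

end Gauge

section IR

variable {G : Type} [Group G] [TopologicalSpace G] [IsTopologicalGroup G] [CompactSpace G]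
  [MeasurableSpace G] [BorelSpace G]

/-- **IR bookkeeping, constant ruler.** From `XiUnbounded r` no `β`-uniform clustering at a FIXED positive rate in
lattice units holds at weak coupling. [folklore] -/
theorem not_concl_const_of_xiUnbounded (r : LatticeRep G) (hXi : XiUnbounded r) {u : ℝ} (hu : 0 < u) :
    ¬ ∃ (c₁ β₂ : ℝ) (S₁ : ℝ → ℕ), 0 < c₁ ∧ ∀ A B : YMSpecies G, ∃ C : ℝ, ∀ β : ℝ, β₂ ≤ β →
        ∀ S n : ℕ, S₁ β ≤ S → n ≤ S →
          |latticeConnectedCorr r.ρ β (2 * S + 1) A.F B.F n| ≤ C * Real.exp (-(c₁ * u * n)) := by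
  rintro ⟨c₁, β₂, S₁, hc₁, hABc⟩
  obtain ⟨A, B, hAB⟩ := hXi
  obtain ⟨C₁, hC₁⟩ := hABc A B
  obtain ⟨β, hβ, hclause⟩ := hAB (c₁ * u / 2) (by positivity) β₂
  obtain ⟨S, hS, n, hn, hlt⟩ := hclause (S₁ β) (max C₁ 1)
  have hup := hC₁ β hβ S n hS hn
  have hpos1 : (0 : ℝ) < max C₁ 1 := lt_max_of_lt_right one_pos
  have hchain : max C₁ 1 * Real.exp (-(c₁ * u / 2 * n)) < max C₁ 1 * Real.exp (-(c₁ * u * n)) :=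
    hlt.trans_le (hup.trans (mul_le_mul_of_nonneg_right (le_max_left _ _) (Real.exp_pos _).le))
  have hexp : Real.exp (-(c₁ * u / 2 * n)) < Real.exp (-(c₁ * u * n)) :=
    lt_of_mul_lt_mul_left hchain hpos1.le
  rw [Real.exp_lt_exp] at hexp
  have hn0 : (0 : ℝ) ≤ n := Nat.cast_nonneg n
  have : 0 < c₁ * u := by positivity
  nlinarith

end IR

/-! ## `a → 0` is load-bearing -/

/-- Deleting `a → 0` from the femto package weakens the hypothesis: the crux WITHOUT `Tendsto` (the body of
`LatticeGapInUVUnitsC` with the conjunct `Filter.Tendsto a Filter.atTop (nhds 0)` removed, verbatim otherwise) implies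
the crux. [folklore] -/
theorem latticeGapInUVUnitsC_of_withoutTendsto
    (h : ∀ (G : Type) [Group G] [TopologicalSpace G] [IsTopologicalGroup G] [CompactSpace G], IsCompactSimpleLieGroup G → letI : MeasurableSpace G := borel G; haveI : BorelSpace G := ⟨rfl⟩; ∀ (r : LatticeRep G) (a : ℝ → ℝ), Continuous a → (∃ (Γ : ℝ → ℝ) (β₀ ℓ₀ c C : ℝ), 0 < ℓ₀ ∧ 0 < c ∧ (∀ β, 0 < a β) ∧ (∀ s : ℝ, 0 < s → s ≤ ℓ₀ → 0 < Γ s ∧ Γ s ≤ 1) ∧ ∀ (L : ℕ) [NeZero L] (β : ℝ), β₀ ≤ β → (L : ℝ) * a β ≤ ℓ₀ → let P : (Fin 4 → ZMod L) → Fin 4 → Fin 4 → GaugeConfig 4 L G → ℝ := fun x i j U => (r.N : ℝ) - (r.ρ (plaquetteHolonomy U x i j)).trace.re; let E : (GaugeConfig 4 L G → ℝ) → ℝ := fun F => wilsonExpectation (d := 4) (L := L) r.ρ β F; let cov : (GaugeConfig 4 L G → ℝ) → (GaugeConfig 4 L G → ℝ) → ℝ := fun F F' => E (fun U => F U * F'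 U) - E F * E F'; let dist : (Fin 4 → ZMod L) → (Fin 4 → ZMod L) → ℝ := fun x y => Real.sqrt (∑ k : Fin 4, (((x k - y k).valMinAbs : ℤ) : ℝ) ^ 2); (∀ n : ℕ, 1 ≤ n → 8 * n ≤ L → c * Γ ((n : ℝ) * a β) ≤ (n : ℝ) ^ 8 * cov (P 0 0 1) (P (Pi.single (2 : Fin 4) ((n : ℕ) : ZMod L)) 0 1) ∧ (n : ℝ) ^ 8 * cov (P 0 0 1) (P (Pi.single (2 : Fin 4) ((n : ℕ) : ZMod L)) 0 1) ≤ C * Γ ((n : ℝ) * a β)) ∧ (∀ (x y : Fin 4 → ZMod L) (i j i' j' : Fin 4), x ≠ y → i ≠ j → i' ≠ j' → |cov (P x i j) (P y i' j')| * dist x y ^ 8 ≤ C * Γ (dist x y * a β))) → ∃ (c₁ β₂ : ℝ) (S₁ : ℝ → ℕ), 0 < c₁ ∧ ∀ A B : YMSpecies G, ∃ C : ℝ, ∀ β : ℝ, β₂ ≤ β → ∀ S n : ℕ, S₁ β ≤ S → n ≤ S → |latticeConnectedCorr r.ρ β (2 * S + 1) A.F B.F n| ≤ C * Real.exp (-(c₁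 * a β * n))) :
    LatticeGapInUVUnitsC := by
  intro G _ _ _ _ hG r a ha hP
  obtain ⟨Γ, β₀, ℓ₀, c, C, hℓ, hc, hpos, -, hΓ, hbox⟩ := hP
  exact h G hG r a ha ⟨Γ, β₀, ℓ₀, c, C, hℓ, hc, hpos, hΓ, fun L _ β h₁ h₂ => hbox L β h₁ h₂⟩

/-- **Negative lemma: `a(β) → 0` is load-bearing in `LatticeGapInUVUnitsC` — modulo `XiUnbounded (suFund N)`
(`N ≥ 2`) the crux without `Tendsto` is false.** `SU(N)` is compact simple unconditionally; the constant ruler `a ≡ 2` is continuous and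
positive and has NO femto box for `ℓ₀ = 1` (`L · 2 ≤ 1` fails for `L ≥ 1`), so it carries the package minus `Tendsto`
vacuously; the conclusion is then clustering at the fixed lattice-unit rate `2 c₁` for all large `β`, against
`XiUnbounded`. Contrapositive for planners: a proof of the crux not using `a → 0` proves `ξ` BOUNDED for every
`SU(N)`. [folklore] -/
theorem latticeGapInUVUnitsC_withoutTendsto_false_of_xiUnbounded {N : ℕ} (hN : 2 ≤ N)
    (hXi : letI : MeasurableSpace (Matrix.specialUnitaryGroup (Fin N) ℂ) := borel _;
      haveI : BorelSpace (Matrix.specialUnitaryGroup (Fin N) ℂ) := ⟨rfl⟩; XiUnbounded (suFund N)) :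
    ¬ ∀ (G : Type) [Group G] [TopologicalSpace G] [IsTopologicalGroup G] [CompactSpace G], IsCompactSimpleLieGroup G → letI : MeasurableSpace G := borel G; haveI : BorelSpace G := ⟨rfl⟩; ∀ (r : LatticeRep G) (a : ℝ → ℝ), Continuous a → (∃ (Γ : ℝ → ℝ) (β₀ ℓ₀ c C : ℝ), 0 < ℓ₀ ∧ 0 < c ∧ (∀ β, 0 < a β) ∧ (∀ s : ℝ, 0 < s → s ≤ ℓ₀ → 0 < Γ s ∧ Γ s ≤ 1) ∧ ∀ (L : ℕ) [NeZero L] (β : ℝ), β₀ ≤ β → (L : ℝ) * a β ≤ ℓ₀ → let P : (Fin 4 → ZMod L) → Fin 4 → Fin 4 → GaugeConfig 4 L G → ℝ := fun x i j U => (r.N : ℝ) - (r.ρ (plaquetteHolonomy U x i j)).trace.re; let E : (GaugeConfig 4 L G → ℝ) → ℝ := fun F => wilsonExpectation (d := 4) (L := L) r.ρ β F; let cov : (GaugeConfig 4 L G → ℝ) → (GaugeConfig 4 L G → ℝ) → ℝ := fun F F' => E (fun U => F U * F' U) - E F * E F'; let dist : (Fin 4 → ZMod L) → (Fin 4 → ZMod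 L) → ℝ := fun x y => Real.sqrt (∑ k : Fin 4, (((x k - y k).valMinAbs : ℤ) : ℝ) ^ 2); (∀ n : ℕ, 1 ≤ n → 8 * n ≤ L → c * Γ ((n : ℝ) * a β) ≤ (n : ℝ) ^ 8 * cov (P 0 0 1) (P (Pi.single (2 : Fin 4) ((n : ℕ) : ZMod L)) 0 1) ∧ (n : ℝ) ^ 8 * cov (P 0 0 1) (P (Pi.single (2 : Fin 4) ((n : ℕ) : ZMod L)) 0 1) ≤ C * Γ ((n : ℝ) * a β)) ∧ (∀ (x y : Fin 4 → ZMod L) (i j i' j' : Fin 4), x ≠ y → i ≠ j → i' ≠ j' → |cov (P x i j) (P y i' j')| * dist x y ^ 8 ≤ C * Γ (dist x y * a β))) → ∃ (c₁ β₂ : ℝ) (S₁ : ℝ → ℕ), 0 < c₁ ∧ ∀ A B : YMSpecies G, ∃ C : ℝ, ∀ β : ℝ, β₂ ≤ β → ∀ S n : ℕ, S₁ β ≤ S → n ≤ S → |latticeConnectedCorr r.ρ β (2 * S + 1) A.F B.F n| ≤ C * Real.exp (-(c₁ * a β * n)) := by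
  intro hcrux
  letI : MeasurableSpace (Matrix.specialUnitaryGroup (Fin N) ℂ) := borel _
  haveI : BorelSpace (Matrix.specialUnitaryGroup (Fin N) ℂ) := ⟨rfl⟩
  have hG : IsCompactSimpleLieGroup (Matrix.specialUnitaryGroup (Fin N) ℂ) :=
    isCompactSimpleLieGroup_specialUnitaryGroup isSimpleCompactGroup_specialUnitaryGroup_holds hN
  have hC := hcrux (Matrix.specialUnitaryGroup (Fin N) ℂ) hG (suFund N) (fun _ => 2) continuous_const
    ⟨fun _ => 1, 0, 1, 1, 1, one_pos, one_pos, fun _ => two_pos, fun s _ _ => ⟨one_pos, le_rfl⟩,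
      fun L _ β _ hL => ?_⟩
  · exact not_concl_const_of_xiUnbounded (suFund N) hXi two_pos hC
  · exfalso
    have h1 : (1 : ℝ) ≤ (L : ℝ) := by exact_mod_cast NeZero.one_le
    linarith

end

end Summit.QuantumFields.YangMills.Theorems.LatticeGapInUVUnitsC.Negative
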